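import Mathlib
import HarnessLib
import Literature.Analysis.FluidPDE.LocalTypeI
import Literature.Analysis.FluidPDE.SelfSimilar
import Literature.Analysis.FluidPDE.AxisymmetricEuler
import Literature.Analysis.FluidPDE.AxisymmetricVorticityTransport
import Summits.NavierStokesRegularity.NavierStokesRegularity.Theorems.SqueezeCycleRecurrentLiouvilleNearIdentityDSS
import Summits.NavierStokesRegularity.NavierStokesRegularity.Theorems.SqueezeCycleRecurrentLiouvilleNearIdentityRDSS

/-!
# Crux `ForcedSymmetry` (stmt-NavierStokesRegularity-4052), line `recurrent-closing` (gen 5), stub `stub_centredWall`: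
# the proved near-identity rungs (`R = 1`, and slow `x₃`-screws; `1 < l < c₁`) re-keyed to the class — NO decay needed

Route `SymmetryModuliCount`, sub-problem `NavierStokesRegularity`.  Support file (everything proved, kind = proof) for
the lead's skeleton `Cruxes/ForcedSymmetry/Lines/recurrent_closing.lean` (gen 5); companion of
`SymmetryModuliCountForcedSymmetryStubCentredWallOfConjecture.lean` (the class bridge from the named wall).

The registered stub `stub_centredWall` (= birth card (b) of crux stmt-NavierStokesRegularity-8561) is the Type-I
rotated-DSS Liouville wall in Albritton–Barker's local Type-I class 𝒦 (suitable weak on `ℝ³ × (−∞,0)`, weak gradient,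
`𝐈 < ∞`, rate `‖w‖ ≤ C/√(−t)`), for EVERY factor `l > 1` and EVERY `R ∈ O(3)`, under the extra space–time decay
`HasTypeIDecay C₀ w` — a named open problem (Bradshaw–Tsai 2017, OP 5.1; Tsai 2018, Conj. 8.8–8.9; Pineau–Vicol 2026,
Conj. 1.1).  Its printed rung without (or with slow) rotation is the near-identity regime `1 < l < λ_*`: Chae–Wolf
2017, Thm 1.3 = Pineau–Vicol 2026, Thm 1.6 / Thm 1.7 (i).  The tree carries that rung IN THE CLASS 𝒦 ITSELF, by
compactness, with the threshold depending on the rate `C` and a bound `M` for `𝐈`, and with NO space–time decay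
hypothesis (`Theorems.stub_rlNearIdentityDSS`, `Theorems.stub_rlNearIdentityRDSSSlow`, crux stmt-1589).  This file
re-keys those two theorems to the stub's clause shape:

* `stub_centredWall_nearIdentity` — `∀ C, ∀ M < ⊤, ∃ c₁ > 1`: every `(w, q, H) ∈ 𝒦` with `𝐈 ≤ M`, rate `C`, and
  `l • w (l² t, l x) = w (t, x)` a.e. on the slab for some `l ∈ (1, c₁)` is regular at the origin (the stub's case
  `R = 1`, with the quantitative `𝐈 ≤ M` in place of `𝐈 < ⊤`; STRONGER than the stub's rung: neither the decay
  `HasTypeIDecay C₀ w` nor the classical pressure is assumed);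
* `stub_centredWall_nearIdentity_rotZ` — the same for the stub's clause with `R = rotZLIE θ` (rotation by `θ` about
  the `x₃`-axis), `|θ| ≤ α₁ log l`: `l • R⁻¹ w (l² t, l R x) = w (t, x)` a.e.; the clause is transported to the
  tree's form `l • w (l² t, l x) = R_θ w (t, R_{−θ} x)` along the measure-preserving rotation `(t, x) ↦ (t, R_{−θ} x)`
  (`rlRDSS_ae_rot_comp`).

References: D. Chae, J. Wolf, Comm. PDE 42 (2017) = arXiv:1610.09464, Thm 1.3 [ChaeWolf2017RemovingDSS]; B. Pineau,
V. Vicol, arXiv:2607.09619 (2026), Thms 1.6–1.7, Conj. 1.1 [PineauVicol2026]; Z. Bradshaw, T.-P. Tsai, Comm. PDE 42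
(2017), §5 OP 5.1 [BradshawTsai2017CPDE]; D. Albritton, T. Barker, J. Math. Fluid Mech. 21 (2019), Lemma 2.2,
Prop. 2.3 [AlbrittonBarker2019].
-/

noncomputable section

-- the summit and its single problem share the name (D-0017 nested layout)
set_option linter.dupNamespace false

open MeasureTheory Set Function Filter
open scoped ENNReal
open Literature.Analysis.FluidPDE

namespace Summit.NavierStokesRegularity.NavierStokesRegularity.Theorems.SymmetryModuliCountForcedSymmetry

/-- **The near-identity rung of `stub_centredWall` in the class, `R = 1`, no decay needed** (Chae–Wolf 2017 Thm 1.3 /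
Pineau–Vicol 2026 Thm 1.6 in Albritton–Barker's class; re-keying of `Theorems.stub_rlNearIdentityDSS`).  For every
rate constant `C` and bound `M < ⊤` there is `c₁ > 1` such that every suitable weak solution `(w, q)` on
`ℝ³ × (−∞,0)` with weak gradient `H`, `𝐈 ≤ M`, the rate `‖w(t,x)‖ ≤ C/√(−t)`, and `l • w (l² t, l x) = w (t, x)`
a.e. on the slab for some `l ∈ (1, c₁)`, is regular at the space–time origin.  This is the stub's case `R = 1`,
`1 < l < c₁`, with `𝐈 ≤ M` in place of `𝐈 < ⊤`, and is STRONGER than that rung of the stub: neither the space–time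
decay `HasTypeIDecay C₀ w` nor a classical pressure is assumed.
[cite: ChaeWolf2017RemovingDSS, Thm 1.3; PineauVicol2026, Theorem 1.6 (arXiv:2607.09619 p. 6)] -/
theorem stub_centredWall_nearIdentity :
    ∀ (C : ℝ) (M : ℝ≥0∞), M < ⊤ → ∃ c₁ : ℝ, 1 < c₁ ∧
      ∀ (w : ℝ → EuclideanSpace ℝ (Fin 3) → EuclideanSpace ℝ (Fin 3)) (q : ℝ → EuclideanSpace ℝ (Fin 3) → ℝ)
        (H : ℝ → EuclideanSpace ℝ (Fin 3) → EuclideanSpace ℝ (Fin 3) →L[ℝ] EuclideanSpace ℝ (Fin 3)),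
        IsSuitableWeakSolutionOn (slab (EuclideanSpace ℝ (Fin 3)) (Set.Iio 0) isOpen_Iio) 1 0 w q →
        HasWeakSpatialGradientOn (slab (EuclideanSpace ℝ (Fin 3)) (Set.Iio 0) isOpen_Iio) w H →
        typeIBound (Set.Iio (0 : ℝ) ×ˢ Set.univ) w q H ≤ M →
        HasTypeITimeDecay C w →
        ∀ l : ℝ, 1 < l → l < c₁ →
          (fun z : ℝ × EuclideanSpace ℝ (Fin 3) => l • (w (l ^ 2 * z.1) (l • z.2)))
            =ᵐ[volume.restrict (Set.Iio (0 : ℝ) ×ˢ Set.univ)]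
              (fun z : ℝ × EuclideanSpace ℝ (Fin 3) => w z.1 z.2) →
          ¬ IsBackwardSingularPoint w 0 := by
  intro C M hM
  obtain ⟨Λ, hΛ, hmain⟩ := Summit.NavierStokesRegularity.NavierStokesRegularity.Theorems.stub_rlNearIdentityDSS C M hM
  refine ⟨Λ, hΛ, fun w q H hsw hwg hI hdec l hl hlc hinv => ?_⟩
  refine hmain l hl hlc w q H hsw hwg hI hdec ?_
  -- `nsRescale l w t x = l • w (l² t) (l • x)`
  filter_upwards [hinv] with z hz
  rw [nsRescale_apply]
  exact hz

/-- **The slowly-spinning near-identity rung of `stub_centredWall` in the class, `R = rotZLIE θ`, no decay needed**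
(Pineau–Vicol 2026 Thm 1.7 (i) in Albritton–Barker's class; re-keying of `Theorems.stub_rlNearIdentityRDSSSlow`).
For every rate constant `C` and bound `M < ⊤` there are `c₁ > 1`, `α₁ > 0` such that every suitable weak solution
`(w, q)` on `ℝ³ × (−∞,0)` with weak gradient `H`, `𝐈 ≤ M`, the rate `‖w(t,x)‖ ≤ C/√(−t)`, which is rotated discretely
self-similar a.e. on the slab about the origin with factor `l ∈ (1, c₁)` and the rotation `R = rotZLIE θ` by `θ` about
the `x₃`-axis, `l • R⁻¹ w (l² t, l R x) = w (t, x)`, `|θ| ≤ α₁ log l`, is regular at the space–time origin.  (The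
stub's clause is transported to the tree's `l • w (l² t, l x) = R_θ w (t, R_{−θ} x)` along the measure-preserving
rotation `(t, x) ↦ (t, R_{−θ} x)`, `rlRDSS_ae_rot_comp`.)  No space–time decay and no classical pressure is assumed.
[cite: PineauVicol2026, Theorem 1.7 (i) (arXiv:2607.09619 p. 7); ChaeWolf2017RemovingDSS, Thm 1.3] -/
theorem stub_centredWall_nearIdentity_rotZ :
    ∀ (C : ℝ) (M : ℝ≥0∞), M < ⊤ → ∃ c₁ α₁ : ℝ, 1 < c₁ ∧ 0 < α₁ ∧
      ∀ (w : ℝ → EuclideanSpace ℝ (Fin 3) → EuclideanSpace ℝ (Fin 3)) (q : ℝ → EuclideanSpace ℝ (Fin 3) → ℝ)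
        (H : ℝ → EuclideanSpace ℝ (Fin 3) → EuclideanSpace ℝ (Fin 3) →L[ℝ] EuclideanSpace ℝ (Fin 3)),
        IsSuitableWeakSolutionOn (slab (EuclideanSpace ℝ (Fin 3)) (Set.Iio 0) isOpen_Iio) 1 0 w q →
        HasWeakSpatialGradientOn (slab (EuclideanSpace ℝ (Fin 3)) (Set.Iio 0) isOpen_Iio) w H →
        typeIBound (Set.Iio (0 : ℝ) ×ˢ Set.univ) w q H ≤ M →
        HasTypeITimeDecay C w →
        ∀ l θ : ℝ, 1 < l → l < c₁ → |θ| ≤ α₁ * Real.log l →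
          (fun z : ℝ × EuclideanSpace ℝ (Fin 3) =>
              l • (rotZLIE θ).symm (w (l ^ 2 * z.1) (l • rotZLIE θ z.2)))
            =ᵐ[volume.restrict (Set.Iio (0 : ℝ) ×ˢ Set.univ)]
              (fun z : ℝ × EuclideanSpace ℝ (Fin 3) => w z.1 z.2) →
          ¬ IsBackwardSingularPoint w 0 := by
  intro C M hM
  obtain ⟨Λ, αlow, hΛ, hα, hmain⟩ :=
    Summit.NavierStokesRegularity.NavierStokesRegularity.Theorems.stub_rlNearIdentityRDSSSlow C M hM
  refine ⟨Λ, αlow, hΛ, hα, fun w q H hsw hwg hI hdec l θ hl hlc hθ hinv => ?_⟩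
  refine hmain l θ hl hlc hθ w q H hsw hwg hI hdec ?_
  -- rotations commute with scalars; `R_φ R_{-φ} = 1`
  have hzs : ∀ (φ a : ℝ) (y : EuclideanSpace ℝ (Fin 3)), rotZ φ (a • y) = a • rotZ φ y := fun φ a y => by
    rw [← rotZL_apply, map_smul, rotZL_apply]
  have hcomp : ∀ (φ : ℝ) (y : EuclideanSpace ℝ (Fin 3)), rotZ φ (rotZ (-φ) y) = y := fun φ y => by
    rw [← rotZ_add, add_neg_cancel, rotZ_zero]
  -- transport the stub's clause along `(t, x) ↦ (t, R_{-θ} x)`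
  have hrot := Summit.NavierStokesRegularity.NavierStokesRegularity.Theorems.rlRDSS_ae_rot_comp
    (F := fun z : ℝ × EuclideanSpace ℝ (Fin 3) => l • (rotZLIE θ).symm (w (l ^ 2 * z.1) (l • rotZLIE θ z.2)))
    (G := fun z : ℝ × EuclideanSpace ℝ (Fin 3) => w z.1 z.2) (-θ) hinv
  filter_upwards [hrot] with z hz
  simp only [rotZLIE_apply, rotZLIE_symm_apply, hcomp] at hz
  -- `hz : l • R_{-θ} (w (l² t) (l • x)) = w t (R_{-θ} x)`; apply `R_θ`
  have key := congrArg (rotZ θ) hz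
  rw [hzs, hcomp] at key
  rw [nsRescale_apply]
  exact key

end Summit.NavierStokesRegularity.NavierStokesRegularity.Theorems.SymmetryModuliCountForcedSymmetry

end
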